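import Mathlib
import HarnessLib
import HarnessLib.Audit
import Summits.NavierStokesRegularity.Statement
import Summits.NavierStokesRegularity.NavierStokesRegularity.Theses.TaoLadderRungThree
import Literature.Analysis.FluidPDE.Tao2016AveragedNS.RestartedCascadeFlows
import Summits.NavierStokesRegularity.NavierStokesRegularity.Theorems.TrappingWindowRungThreeRestartControl
import Summits.NavierStokesRegularity.NavierStokesRegularity.Theorems.TrappingWindowRungThreeRestartGlue
import Summits.NavierStokesRegularity.NavierStokesRegularity.Theorems.TrappingWindowRungThreeLocalDynamicsSufficesAt
import HarnessLib.Audit.Status.Attr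

/-!
Route: HeteroclinicTriggerChain

DORMANT since 2026-09-02T04:00:54Z (reconciler: no traction for 5 d (last activity item-evidence-added at 2026-08-28T03:01:00Z); parked, not closed — `ledger route dormant route-NavierStokesRegularity-HeteroclinicTriggerChain --off` to ) — unstaffed, not closed; items shared with open routes are served there. `ledger route dormant <id> --off` reactivates.

# Route HeteroclinicTriggerChain — unfold a complete-transfer heteroclinic chain by one seed
constant ⇒ dyadic rung M3

It suffices to show X = TriggerChainTable ∧ TriggerChainFrontStep (with the three CLOSED supports
RestartControl, RestartGlue,
LocalDynamicsSufficesAt of the host route TaoLadderRungThree). Dictionary (card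
heteroclinic-trigger-chain; every entry a tree decl over
`TaoCascade.quadTerm 1`): isotropy / invariant subspace ↦ the PURE-MODE equilibrium family (only
mode i₀ charged; no structure constant with two
i₀-inputs); robust saddle connection in an invariant plane ↦ the COMPLETE-TRANSFER ARC x′ = −eu², u′
= exu − guy, y′ = gu² with e = g, whose
unstable manifold x + y = 1 runs from the pure state at shell n EXACTLY to the pure state at shell
n+1 (efficiency 1 > 1/2 = the λ = 2
dissipation threshold); ℤ₂-isotropy ↦ parity in the trigger mode i₁; unfolding parameter ↦ ONE seed
constant β = 1/R coupling (x,u) to the upper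
trigger; saddle passage time ↦ the delay log(1/β)/e that keeps the receiver silent; the unfolded
chain's periodic orbit ↦ a discretely
self-similar blow-up orbit with FIXED seed ≍ β, hence hyperbolic with margin against (4.8)–(4.10)
defects of relative size K·2^(−n/2).
TriggerChainTable says such an unseeded chain exists in the comparable class; TriggerChainFrontStep
says a small seed unfolds it into a robust
front step (`FrontStepAt 1 (R/β)` with the table pinned); the supports carry it to RUNG TL-M3
(Theses.TaoLadderRungThree.Target). This is a
LINE on a rung: no summit is proved by it.
Lean: `Summit.NavierStokesRegularity.NavierStokesRegularity.Theses.TaoLadderRungThree.Target`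

## Assembly
Pure logic plus the host route's positivity arithmetic, PROVED in glue2.lean / Sketch2.lean
(`closes`, kernel-checked, rc 0, 0 sorries): from
TriggerChainTable take (R, α₀, σ, chain); TriggerChainFrontStep gives β ∈ (0,1] and the body of
FrontStepAt 1 (R/β) for α₀ + βσ (so 1 ≤ R/β);
RestartControl restarts the local pseudo-solution at the last checkpoint (horizon clause t_N +
c·2^(−5N/2)/e_N ≤ T ⇔ c ≤ (T − t_N)γ), RobustStep
steps the restarted (η,η)-flow, RestartGlue re-reads the StepTo as a level-(N+1) checkpoint, giving
DynamicsLocalAt 1 (R/β); LocalDynamicsSufficesAt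
1 (R/β) yields a table in E₂(R/β) with NoGlobalCascade 1, i.e. Theses.TaoLadderRungThree.Target with
spread R/β (closes_target TaoLadderM3, class rung).

CLOSES_TARGET: closes rung TL-M3 of NavierStokesRegularity: Summit.NavierStokesRegularity.NavierStokesRegularity.Theses.TaoLadderRungThree.Target (D-0061; not the summit Statement) — the deciding theorem of this route concludes that registered leaf instead of the Statement decl `NavierStokesRegularity` (class rung: servable and labelled, never counted as concluding the summit Statement).

Rationale: WHY THIS LINE. Rung M3 (λ = 2, comparable table, Theorem-4.2-level robust blow-up) is open because
at the dyadic ratio generic cascades pass < 1/2 of the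
energy per hop (K41-class fronts ≈ 2^(−5/3); the M3 cell's best screen μ = 0.554 at R = 64) while
dissipation 2^(2n) kills anything below 1/2,
and Tao's delay circuit [Tao2016AveragedNS = arXiv:1402.0290 §§5–6] needs the hierarchy 1 ≪ 1/ε₀ ≪ K
≪ 1/ε. Imported from equivariant dynamics:
robust heteroclinic cycles between equilibria in invariant subspaces and their unfoldings
[Krupa–Melbourne 1995 doi:10.1017/S0143385700008282;
Guckenheimer–Holmes / Busse–Heikes cycle,
corpus:book:holmes2012-turbulence-coherent-structures-dynamical-systems-symmetry p.230–232;
galaxy:panama:239264038125576 Golubitsky–Stewart]: the pure-mode family is an equilibrium manifold,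
the pump-depletion arc is an exact
complete-transfer connection between shift-related pure states, and a single small seed constant β
unfolds the chain into a self-similar orbit
whose delay log(1/β) comes from hyperbolicity, not from a magnitude hierarchy; Tao's robustness
requirement is met because the seed stays ≍ β
(a Krupa–Melbourne-stable chain with seeds → 0 could be pinned by admissible defects — the reason
the design is an UNFOLDING, not a stable cycle).
What it does that listed routes do not: TaoLadderRungThree (K_A DyadicGapCertificate / K_B
GappedFrontRobust) and TrappingWindowRungThree certify a
NUMERICALLY found profile by a contracting-ball / trapping-window certificate; here the orbit, the
efficiency and the margin are analytic consequences
of a designed saddle structure, and the universal crux pins the table (no certificate format, no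
interval arithmetic). arXiv:2501.07377 p.8 sees
heteroclinic components behind Sabra's DSS blow-up numerically; nothing there is designed, robust,
or in Tao's class. PRIOR ART ADDED after critic idea-crit-3 (P5, 2026-08-27T21:26Z; references
supplied by the critic): Tao's own delayed-trigger circuit [arXiv:1402.0290 §§5–6] (delay from a
tiny coupling under 1/ε₀ ≪ K ≪ 1/ε), the trigger-free complete monotone transfer of Katz–Pavlović
2005 / Cheskidov 2008 (pure states are not equilibria there — the premature-leak problem the trigger
solves), and pump depletion in resonant three-wave systems (Manley–Rowe; Craik ch. 5) as the arc's
ancestry; the delta is ONE constant β = 2/R plus the exact complete-transfer arc at finite rates e =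
g (tree theorem heteroclinicTriggerChain_transferArc_complete, p573423).

RANKED CRUXES. #2 TriggerChainFrontStep (crux) — TRIGGER-CHAIN THEOREM. For every R ≥ 1 and every
pair of tables (α₀, σ) with α₀ ∈ E₂(R) and α₀ + βσ ∈ E₂(R/β) for all β ∈ (0,1], carrying an UNSEEDED
TRIGGER CHAIN — modes i₀ ≠ i₁ and rates e, κ, K > 0, a rate table d and an entire family H with:
(purity) mode-i₀-only families are zeros of quadTerm 1 for both tables; (parity) every structure
constant of either table with an odd number of i₁-slots vanishes; (saddle) the polarisation of
quadTerm 1 α₀ at the pure state (i₀, shell 0, amplitude 1) is diagonal with entries d, d(i₁,0) = e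
and all other entries ≤ 0; (connection) H is an exact entire solution for α₀ supported on shell 0
and the receiver (i₀,1), tending to the pure state at shell 0 as t → −∞ and to the pure state at
shell 1 (amplitude 1: complete transfer) as t → +∞, with |H − E₋| ≤ K e^(et) and K⁻¹e^(et) ≤
|H_(i₁,0)| for t ≤ 0 and |H − E₊| ≤ K e^(−κt) for t ≥ 0; (seed) quadTerm 1 σ H does not vanish
identically at the upper trigger (i₁,1) — there is β ∈ (0,1] and a robust front step for the pinned
table α₀ + βσ at spread R/β: θ ∈ [0,1/2], clock c > 0, margin η > 0, observable mode, one-shell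
datum, a transition-state description P holding at the rescaled datum, an envelope env, with
`FrontExists 1 θ c η (α₀+βσ) P env` and `RobustStep 1 θ c η j₀ (α₀+βσ) P env` (card item K1).
[difficulty: XL] (why it might fail: centre directions at the pure state (the equilibrium family,
unseeded far triggers) or the infinite tails may leak under (4.8)–(4.10) defects during the log(1/β)
wait, breaking self-similarity of the seed; or FrontExists fails for every admissible P.)
[doi:10.1017/S0143385700008282,
corpus:book:holmes2012-turbulence-coherent-structures-dynamical-systems-symmetry, Tao2016AveragedNS,
arXiv:1402.0290]
#3 TriggerChainTable (crux) — Some R ≥ 1 and some pair (α₀, σ) of four-mode Tao-topology tables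
carry an unseeded trigger chain in the sense of the previous block (same clauses, existentially).
Intended witness: three structure constants — trigger growth e (same-shell (i₀,i₁)→i₁ with
cancelling partner −e: (i₁,i₁)→i₀), transfer g = e ((i₁,i₁) at shell n → (i₀, n+1) with partners
−g/2), seed σ = ((i₀,i₁) at shell n → (i₁, n+1) with partners) — and H the explicit arc on x + y =
1, u² = 2xy (card item K2). [difficulty: M] (why it might fail: the cancellation rule (4.3) with the
weights 2^(5(n−μ₃)/2) may force a partner constant that breaks purity, parity or the sign pattern d
≤ 0 off the trigger, or e = g may be incompatible with |α| ∈ {0} ∪ [1/R,1] symmetric tables.)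
[Tao2016AveragedNS, arXiv:1402.0290]
#9 RestartControl (support) — Tao's scale covariance at a checkpoint (host route TaoLadderRungThree
item stmt-NavierStokesRegularity-20424, CLOSED): restarting a local pseudo-solution at the level-N
checkpoint gives an (η,η)-pseudo-flow with admissible slack on the remaining horizon. [difficulty:
provable-now] [Tao2016AveragedNS]
#9 RestartGlue (support) — restart bookkeeping (host item stmt-NavierStokesRegularity-20425,
CLOSED): a StepTo of the restarted flow is a level-(N+1) epoch checkpoint of the original
pseudo-solution. [difficulty: provable-now] [Tao2016AveragedNS]
#9 LocalDynamicsSufficesAt (support) — the local robust induction suffices (host item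
stmt-NavierStokesRegularity-20426, CLOSED): DynamicsLocalAt ε₀ R gives a table in E₂(R) with
NoGlobalCascade ε₀. [difficulty: provable-now] [Tao2016AveragedNS]

TWO-LAYER PLAN. Foreseen split of TriggerChainFrontStep once TriggerChainTable closes: C₁ = exact
hop map (defect-free flows of α₀ + βσ from the seeded in-section
return to the rescaled in-section with seed ≍ β and wake O(β^(2λ^(−5/2))) ≈ O(β^0.35) at λ = 2
(numerics j291070; the earlier O(β²) guess ignored premature ignition), finite active block +
super-geometric tails) → C₂ = margin (the same under (η,η)-defects
with η ≍ β², via hyperbolicity of the saddle passage) → TriggerChainFrontStep; glue = choice of P as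
the seeded collar and env from the tail bounds.

KILL CRITERIA. Refutation of TriggerChainTable for ALL sparse designs (a lemma that (4.2)–(4.3)
force every comparable table with a pure-mode equilibrium family to
have no complete-transfer connection) closes the route (close --reason refuted:TriggerChainTable). A
pseudo-solution of the intended witness table
that is GLOBAL from the seeded datum for some K₁, K₂ and arbitrarily large n₀ (defects pinning the
trigger) refutes TriggerChainFrontStep as typed and
forces a pivot to a two-seed design (seed refreshed from the hop below AND from the wake). If
TaoLadderRungThree or TrappingWindowRungThree closes
TL-M3 first, this route is mooted as a rung closer but its cruxes remain meaningful (an analytic,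
certificate-free proof).

NOT DECOMPOSED YET. The choice of the description P (seeded collar around the chain), the tail
envelope env, the local existence clause FrontExists for P-states, and the
quantitative saddle-passage lemma (entry seed δ ↦ exit after log(h/δ)/e with transverse error
O(δ^(κ/e))) are layer-2 children of TriggerChainFrontStep.

CHEAPEST FALSIFIER. One page by hand: write the three-constant table, impose symmetry (4.2) and
cancellation (4.3) with the weights 2^(5(n−μ₃)/2), and check (i) purity,
(ii) parity, (iii) the diagonal linearisation signs at the pure state (trigger +e; lower trigger
−g·2^(−5/2); everything else 0). Done here
informally: (4.3) gives partners α_(i₁i₁i₀,(000)) = −e for the trigger pair and α_(i₁i₀i₁,(010)) =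
α_(i₀i₁i₁,(100)) = −g/2 for the transfer, and the
rescaled three-mode system is exactly x′ = −eu², u′ = exu − guy, y′ = gu² (energy-conserving,
invariant line gx + ey = g, complete transfer iff
e = g). Next cheapest: integrate the two-shell truncation of α₀ + βσ with β = 10⁻³ (kit, minutes)
and look for the self-similar hop with seed ≍ β.

NUMBERS. Dissipation threshold at λ = 2: transferred fraction per hop must exceed 1/2 (θ ≤ 1/2 in
FrontStepAt); K41-class fronts ≈ 2^(−5/3) ≈ 0.315; M3
cell screen μ_max(64) = 0.554 (host route header); designed arc: exactly 1 for the isolated hop;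
along the CHAIN the measured per-hop ratio (kit j291070/j291331) is μ(R) = 0.472 (R=64), 0.588
(128), 0.651 (200), 0.858 (2000), 0.93 (2·10⁴) — loss ≈ 1.6·R^(−0.35) = O(β^(2λ^(−5/2))) from
premature ignition of the next trigger on its 2^(5/2)-faster clock, NOT O(β²); μ > 1/2 from R ≈ 100
on. Hop clock at shell n+1 relative to n: 2^(5/2) ≈ 5.66; wait ≈ log(1/β)/e.

DEFINITION REQUESTS. None: quadTerm, InTableClass, datumState, datumEnergy, FrontExists, RobustStep,
FrontStepAt, DynamicsLocalAt all exist in the tree.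

Novelty: Searches (2026-08-27): lit search --hybrid "robust heteroclinic cycle stability resonance
bifurcation periodic orbit Krupa Melbourne" (8 textbook hits:
Haragus–Iooss, Kuznetsov, Holmes–Lumley–Berkooz); lit search "heteroclinic cycle shell model
turbulence" (4); lit search "heteroclinic shell model
blow-up" (arXiv:2501.07377 p.8, p.13); lit vsearch "<periodic orbit born from a heteroclinic cycle
at eigenvalue ratio one>" (8 textbooks); lit search
--hybrid "resonant triad complete energy exchange invariant manifold heteroclinic connection pure
modes" (6); lit galaxy search "heteroclinic
cycle|resonance bifurcation|Krupa" --star all (0 relevant) and "Busse-Heikes|Guckenheimer-Holmes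
cycle|heteroclinic ratchet" --star all (Golubitsky–Stewart
panama:239264038125576, Chossat (ed.) panama:275556511776783, Field pdf:-4104305982237793320);
ledger route ls / idea list NavierStokesRegularity grep
"heteroclinic|trigger|saddle|pure mode" (none; nearest TaoLadderRungThree, TrappingWindowRungThree).
Nearest prior art found: arXiv:2501.07377 (Sabra DSS blow-up profiles organised by a homoclinic
explosion with heteroclinic components, numerical);
host route route-NavierStokesRegularity-TaoLadderRungThree (numerical profile + interval certificate
at R = 64).
Delta: the blow-up orbit at λ = 2 is produced analytically by unfolding a DESIGNED complete-transfer
heteroclinic chain of pure-mode saddles with one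
explicit seed constant, so that both the > 1/2 efficiency and Tao's robustness margin com  [refs: 2501.07377]

Barriers (technique_class: heteroclinic-chain unfolding, equivariant dynamics): - technique_class: heteroclinic-chain unfolding, equivariant dynamics
- Literature.Barriers.NavierStokesRegularity.DyadicCascadeRegularity: evaded by hypothesis — BMR
2011 covers the scalar monotone dyadic chain (every
  charged shell radiates at once); here the receiver is a non-radiating pure mode gated by a
parity-odd trigger, a 4-mode Tao-topology table outside
  the barrier's class; the barrier's leakage mechanism is exactly what purity switches off.
- Literature.Barriers.NavierStokesRegularity (averaged-operator / AveragedTypeIBlowup objections):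
not engaged — the line closes class rung TL-M3
  only and claims nothing about NS.
- Negatives index: stmt-1376, 4055, 1832, 1429, 0154 are NS-side statements; none concerns
comparable cascade tables; steered around trivially.

History (route lifecycle, newest last):
- 2026-09-02T04:00:54Z · DORMANT — reconciler: no traction for 5 d (last activity item-evidence-added at 2026-08-28T03:01:00Z); parked, not closed — `ledger route dormant route-NavierStokesRegula (operator:999:90858)

sub-problem: NavierStokesRegularity · status: dormant · opened planner-ns-idea-4-g0-0 2026-08-27T21:15:55Z · rev 1 · ledger route-NavierStokesRegularity-HeteroclinicTriggerChain
GENERATED by the gate from the ledger (D-0016/17). Provers cite these decls: `theorem foo : Summit.NavierStokesRegularity.NavierStokesRegularity.Theses.HeteroclinicTriggerChain.<Decl> := …` in Summits/NavierStokesRegularity/NavierStokesRegularity/Theorems/<Name>.lean.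
-/

namespace Summit.NavierStokesRegularity.NavierStokesRegularity.Theses.HeteroclinicTriggerChain

open scoped BigOperators Topology Manifold Classical MeasureTheory ProbabilityTheory Matrix InnerProductSpace ComplexConjugate ContinuousMap
open Filter Set Function TopologicalSpace MeasureTheory

attribute [summit_statement] _root_.NavierStokesRegularity
attribute [summit_statement] _root_.Summit.NavierStokesRegularity.NavierStokesRegularity.Theses.TaoLadderRungThree.Target

open Literature.NS

/-- item stmt-NavierStokesRegularity-22785 · crux · rank 2 · open · by planner
why it might fail: centre directions at the pure state (the equilibrium family, unseeded far triggers) or the infinite tails may leak under (4.8)–(4.10) defects during the log(1/β) wait, breaking self-similarity of the seed; or FrontExists fails for every admissible P.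
sources: doi:10.1017/S0143385700008282, corpus:book:holmes2012-turbulence-coherent-structures-dynamical-systems-symmetry, Tao2016AveragedNS, arXiv:1402.0290
[crux] TRIGGER-CHAIN THEOREM. For every R ≥ 1 and every pair of tables (α₀, σ) with α₀ ∈ E₂(R) and
α₀ + βσ ∈ E₂(R/β) for all β ∈ (0,1], carrying an UNSEEDED TRIGGER CHAIN — modes i₀ ≠ i₁ and rates e,
κ, K > 0, a rate table d and an entire family H with: (purity) mode-i₀-only families are zeros of
quadTerm 1 for both tables; (parity) every structure constant of either table with an odd number of
i₁-slots vanishes; (saddle) the polarisation of quadTerm 1 α₀ at the pure state (i₀, shell 0,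
amplitude 1) is diagonal with entries d, d(i₁,0) = e and all other entries ≤ 0; (connection) H is an
exact entire solution for α₀ supported on shell 0 and the receiver (i₀,1), tending to the pure state
at shell 0 as t → −∞ and to the pure state at shell 1 (amplitude 1: complete transfer) as t → +∞,
with |H − E₋| ≤ K e^(et) and K⁻¹e^(et) ≤ |H_(i₁,0)| for t ≤ 0 and |H − E₊| ≤ K e^(−κt) for t ≥ 0;
(seed) quadTerm 1 σ H does not vanish identically at the upper trigger (i₁,1) — there is β ∈ (0,1]
and a robust front step for the pinned table α₀ + βσ at spread R/β: θ ∈ [0,1/2], clock c > 0, margin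
η > 0, observable mode, one-shell datum, a transition-state description P holding at the rescaled
datum, an en -/
@[route_item "route-NavierStokesRegularity-HeteroclinicTriggerChain", crux]
def TriggerChainFrontStep : Prop :=
  ∀ R : ℝ, 1 ≤ R → ∀ α₀ σ : Fin 4 → Fin 4 → Fin 4 → ℤ × ℤ × ℤ → ℝ, (Literature.Analysis.FluidPDE.TaoCascade.InTableClass R α₀ ∧ (∀ β : ℝ, 0 < β → β ≤ 1 → Literature.Analysis.FluidPDE.TaoCascade.InTableClass (R / β) (fun j₁ j₂ j₃ μ => α₀ j₁ j₂ j₃ μ + β * σ j₁ j₂ j₃ μ)) ∧ ∃ (i₀ i₁ : Fin 4) (e κ K : ℝ) (d : Fin 4 → ℤ → ℝ) (H : Fin 4 → ℤ → ℝ → ℝ), i₀ ≠ i₁ ∧ 0 < e ∧ 0 < κ ∧ 0 < K ∧ (∀ X : Fin 4 → ℤ → ℝ → ℝ, (∀ i n t, i ≠ i₀ → X i n t = 0) → ∀ i n t, Literature.Analysis.FluidPDE.TaoCascade.quadTerm 1 α₀ X i n t = 0 ∧ Literature.Analysis.FluidPDE.TaoCascade.quadTerm 1 σ X i n t = 0)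 ∧ (∀ (j₁ j₂ j₃ : Fin 4) (μ : ℤ × ℤ × ℤ), Xor' (Xor' (j₁ = i₁) (j₂ = i₁)) (j₃ = i₁) → α₀ j₁ j₂ j₃ μ = 0 ∧ σ j₁ j₂ j₃ μ = 0) ∧ (∀ (Y : Fin 4 → ℤ → ℝ → ℝ) (i : Fin 4) (n : ℤ) (t : ℝ), Literature.Analysis.FluidPDE.TaoCascade.quadTerm 1 α₀ (fun j m s => (fun j m (_ : ℝ) => if j = i₀ ∧ m = 0 then (1 : ℝ) else 0) j m s + Y j m s) i n t - Literature.Analysis.FluidPDE.TaoCascade.quadTerm 1 α₀ (fun j m (_ : ℝ) => if j = i₀ ∧ m = 0 then (1 : ℝ) else 0) i n t - Literature.Analysis.FluidPDE.TaoCascade.quadTerm 1 α₀ Y i n t = d i n * Y i n t) ∧ d i₁ 0 = e ∧ (∀ i n, ¬ (i = i₁ ∧ n = 0) → d i n ≤ 0) ∧ (∀ i n t, HasDerivAt (H i n) (Literature.Analysis.FluidPDE.TaoCascade.quadTerm 1 α₀ H i n t) t) ∧ (∀ i n t, n < 0 → H i n t = 0) ∧ (∀ i n t, 1 ≤ n →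 i ≠ i₀ → H i n t = 0) ∧ (∀ i n t, 2 ≤ n → H i n t = 0) ∧ (∀ i n, Filter.Tendsto (H i n) Filter.atBot (nhds (if i = i₀ ∧ n = 0 then (1 : ℝ) else 0))) ∧ (∀ i n, Filter.Tendsto (H i n) Filter.atTop (nhds (if i = i₀ ∧ n = 1 then (1 : ℝ) else 0))) ∧ (∀ i n t, t ≤ 0 → |H i n t - (if i = i₀ ∧ n = 0 then (1 : ℝ) else 0)| ≤ K * Real.exp (e * t)) ∧ (∀ t : ℝ, t ≤ 0 → K⁻¹ * Real.exp (e * t) ≤ |H i₁ 0 t|) ∧ (∀ i n t, 0 ≤ t → |H i n t - (if i = i₀ ∧ n = 1 then (1 : ℝ) else 0)| ≤ K * Real.exp (-(κ * t))) ∧ (∃ t : ℝ, Literature.Analysis.FluidPDE.TaoCascade.quadTerm 1 σ H i₁ 1 t ≠ 0)) → ∃ β : ℝ, 0 < β ∧ β ≤ 1 ∧ ∃ (θ c η : ℝ) (j₀ : Fin 4) (X₀ : Fin 4 → ℝ) (P : (Fin 4 → ℤ → ℝ) → (Fin 4 → ℤ → ℝ) → Prop) (env : ℤ → ℝ), 0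 ≤ θ ∧ θ ≤ 1 / 2 ∧ 0 < c ∧ 0 < η ∧ Literature.Analysis.FluidPDE.TaoCascade.InTableClass (R / β) (fun j₁ j₂ j₃ μ => α₀ j₁ j₂ j₃ μ + β * σ j₁ j₂ j₃ μ) ∧ X₀ j₀ ≠ 0 ∧ P (Literature.Analysis.FluidPDE.TaoCascade.datumState j₀ X₀) (Literature.Analysis.FluidPDE.TaoCascade.datumEnergy j₀ X₀) ∧ Literature.Analysis.FluidPDE.TaoCascade.FrontExists 1 θ c η (fun j₁ j₂ j₃ μ => α₀ j₁ j₂ j₃ μ + β * σ j₁ j₂ j₃ μ) P env ∧ Literature.Analysis.FluidPDE.TaoCascade.RobustStep 1 θ c η j₀ (fun j₁ j₂ j₃ μ => α₀ j₁ j₂ j₃ μ + β * σ j₁ j₂ j₃ μ) P env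

/-- item stmt-NavierStokesRegularity-22786 · crux · rank 3 · closed · proved by Summit.NavierStokesRegularity.NavierStokesRegularity.Theorems.heteroclinicTriggerChain_triggerChainTable_proof (prover) · by planner
why it might fail: the cancellation rule (4.3) with the weights 2^(5(n−μ₃)/2) may force a partner constant that breaks purity, parity or the sign pattern d ≤ 0 off the trigger, or e = g may be incompatible with |α| ∈ {0} ∪ [1/R,1] symmetric tables.
sources: Tao2016AveragedNS, arXiv:1402.0290
[crux] Some R ≥ 1 and some pair (α₀, σ) of four-mode Tao-topology tables carry an unseeded trigger
chain in the sense of the previous block (same clauses, existentially). Intended witness: three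
structure constants — trigger growth e (same-shell (i₀,i₁)→i₁ with cancelling partner −e:
(i₁,i₁)→i₀), transfer g = e ((i₁,i₁) at shell n → (i₀, n+1) with partners −g/2), seed σ = ((i₀,i₁)
at shell n → (i₁, n+1) with partners) — and H the explicit arc on x + y = 1, u² = 2xy (card item
K2). [difficulty: M] -/
@[route_item "route-NavierStokesRegularity-HeteroclinicTriggerChain", crux]
def TriggerChainTable : Prop :=
  ∃ R : ℝ, 1 ≤ R ∧ ∃ α₀ σ : Fin 4 → Fin 4 → Fin 4 → ℤ × ℤ × ℤ → ℝ, Literature.Analysis.FluidPDE.TaoCascade.InTableClass R α₀ ∧ (∀ β : ℝ, 0 < β → β ≤ 1 → Literature.Analysis.FluidPDE.TaoCascade.InTableClass (R / β) (fun j₁ j₂ j₃ μ => α₀ j₁ j₂ j₃ μ + β * σ j₁ j₂ j₃ μ)) ∧ ∃ (i₀ i₁ : Fin 4) (e κ K : ℝ) (d : Fin 4 → ℤ → ℝ) (H : Fin 4 → ℤ → ℝ → ℝ), i₀ ≠ i₁ ∧ 0 < e ∧ 0 < κ ∧ 0 < K ∧ (∀ X : Fin 4 → ℤ → ℝ → ℝ,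 (∀ i n t, i ≠ i₀ → X i n t = 0) → ∀ i n t, Literature.Analysis.FluidPDE.TaoCascade.quadTerm 1 α₀ X i n t = 0 ∧ Literature.Analysis.FluidPDE.TaoCascade.quadTerm 1 σ X i n t = 0) ∧ (∀ (j₁ j₂ j₃ : Fin 4) (μ : ℤ × ℤ × ℤ), Xor' (Xor' (j₁ = i₁) (j₂ = i₁)) (j₃ = i₁) → α₀ j₁ j₂ j₃ μ = 0 ∧ σ j₁ j₂ j₃ μ = 0) ∧ (∀ (Y : Fin 4 → ℤ → ℝ → ℝ) (i : Fin 4) (n : ℤ) (t : ℝ), Literature.Analysis.FluidPDE.TaoCascade.quadTerm 1 α₀ (fun j m s => (fun j m (_ : ℝ) => if j = i₀ ∧ m = 0 then (1 : ℝ) else 0) j m s + Y j m s) i n t - Literature.Analysis.FluidPDE.TaoCascade.quadTerm 1 α₀ (fun j m (_ : ℝ) => if j = i₀ ∧ m = 0 then (1 : ℝ) else 0) i n t - Literature.Analysis.FluidPDE.TaoCascade.quadTerm 1 α₀ Y i n t = d i n * Y i n t) ∧ d i₁ 0 = e ∧ (∀ i n, ¬ (i = i₁ ∧ n = 0) → d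 i n ≤ 0) ∧ (∀ i n t, HasDerivAt (H i n) (Literature.Analysis.FluidPDE.TaoCascade.quadTerm 1 α₀ H i n t) t) ∧ (∀ i n t, n < 0 → H i n t = 0) ∧ (∀ i n t, 1 ≤ n → i ≠ i₀ → H i n t = 0) ∧ (∀ i n t, 2 ≤ n → H i n t = 0) ∧ (∀ i n, Filter.Tendsto (H i n) Filter.atBot (nhds (if i = i₀ ∧ n = 0 then (1 : ℝ) else 0))) ∧ (∀ i n, Filter.Tendsto (H i n) Filter.atTop (nhds (if i = i₀ ∧ n = 1 then (1 : ℝ) else 0))) ∧ (∀ i n t, t ≤ 0 → |H i n t - (if i = i₀ ∧ n = 0 then (1 : ℝ) else 0)| ≤ K * Real.exp (e * t)) ∧ (∀ t : ℝ, t ≤ 0 → K⁻¹ * Real.exp (e * t) ≤ |H i₁ 0 t|) ∧ (∀ i n t, 0 ≤ t → |H i n t - (if i = i₀ ∧ n = 1 then (1 : ℝ) else 0)| ≤ K * Real.exp (-(κ * t))) ∧ (∃ t : ℝ, Literature.Analysis.FluidPDE.TaoCascade.quadTerm 1 σ H i₁ 1 t ≠ 0)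

-- `TriggerChainTable` holds: proved by `Summit.NavierStokesRegularity.NavierStokesRegularity.Theorems.heteroclinicTriggerChain_triggerChainTable_proof` (its module imports this route file, so no `_holds` link can be stated here).

/-- item stmt-NavierStokesRegularity-21750 · support · rank 9 · closed · proved by Summit.NavierStokesRegularity.NavierStokesRegularity.Theorems.trappingWindowRungThree_restartControl_proof (prover) · by planner
sources: Tao2016AveragedNS
[support] Restart support of route TaoLadderRungThree (item closed · proved by
`Summit.NavierStokesRegularity.NavierStokesRegularity.Theorems.taoLadderRungTwo_restartControl_proof`),
re-wanted verbatim: the restarted, rescaled flow of a cascade ODE solution at a checkpoint is a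
PseudoFlowOn flow on the available horizon with slack under η·slackWeight, for all levels n₀ ≥
N₀(K₁, K₂). [difficulty: provable-now] -/
@[route_item "route-NavierStokesRegularity-HeteroclinicTriggerChain", crux]
def RestartControl : Prop :=
  ∀ (ε₀ θ c η : ℝ) (i₀ : Fin 4) (α : Fin 4 → Fin 4 → Fin 4 → ℤ × ℤ × ℤ → ℝ) (X₀ : Fin 4 → ℝ) (P : (Fin 4 → ℤ → ℝ) → (Fin 4 → ℤ → ℝ) → Prop) (env : ℤ → ℝ) (K₁ K₂ : ℝ), 0 < ε₀ → θ ≤ 1 / 2 → 0 ≤ c → 0 < η → X₀ i₀ ≠ 0 → 0 ≤ K₁ → 0 ≤ K₂ → ∃ N₀ : ℤ, ∀ n₀ : ℤ, N₀ ≤ n₀ → ∀ T : ℝ, 0 < T → ∀ X E : Fin 4 → ℤ → ℝ → ℝ, Literature.Analysis.FluidPDE.TaoCascade.CascadeODESolutionOn T ε₀ α K₁ K₂ n₀ X₀ X E → ∀ N : ℤ, n₀ ≤ N → ∀ t e : ℤ → ℝ, Literature.Analysis.FluidPDE.TaoCascade.EpochCheckpoints ε₀ θ c i₀ n₀ X₀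 P (Literature.Analysis.FluidPDE.TaoCascade.epochEnvelope env) N X E t e → t N < T → Literature.Analysis.FluidPDE.TaoCascade.PseudoFlowOn ((T - t N) * (e N * (1 + ε₀) ^ ((5 : ℝ) * N / 2))) ε₀ α η η (fun i k => X i (N + k) (t N) / e N) (fun i k => E i (N + k) (t N) / e N ^ 2) (Literature.Analysis.FluidPDE.TaoCascade.restartSlack ε₀ K₂ N (t N) (e N) E) (Literature.Analysis.FluidPDE.TaoCascade.restartX ε₀ N (t N) (e N) X) (Literature.Analysis.FluidPDE.TaoCascade.restartE ε₀ N (t N) (e N) E) ∧ ∀ i k, 0 ≤ Literature.Analysis.FluidPDE.TaoCascade.restartSlack ε₀ K₂ N (t N) (e N) E i k ∧ Literature.Analysis.FluidPDE.TaoCascade.restartSlack ε₀ K₂ N (t N) (e N) E i k ≤ η * Literature.Analysis.FluidPDE.TaoCascade.slackWeight ε₀ θ c env (N - n₀).toNat k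

/-- `RestartControl` holds: proved by `Summit.NavierStokesRegularity.NavierStokesRegularity.Theorems.trappingWindowRungThree_restartControl_proof`. -/
theorem RestartControl_holds : RestartControl := _root_.Summit.NavierStokesRegularity.NavierStokesRegularity.Theorems.trappingWindowRungThree_restartControl_proof

/-- item stmt-NavierStokesRegularity-21751 · support · rank 9 · closed · proved by Summit.NavierStokesRegularity.NavierStokesRegularity.Theorems.exactWindowRungThree_restartGlue_proof (prover) · by planner
sources: Tao2016AveragedNS
[support] Restart support of route TaoLadderRungThree (item closed · proved by
`Summit.NavierStokesRegularity.NavierStokesRegularity.Theorems.taoLadderRungTwo_restartGlue_proof`),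
re-wanted verbatim: a StepTo of the restarted flow extends the epoch checkpoints from N to N+1.
[difficulty: provable-now] -/
@[route_item "route-NavierStokesRegularity-HeteroclinicTriggerChain", crux]
def RestartGlue : Prop :=
  ∀ (ε₀ θ c : ℝ) (m : ℕ) (i₀ : Fin m) (n₀ : ℤ) (X₀ : Fin m → ℝ) (P Q : (Fin m → ℤ → ℝ) → (Fin m → ℤ → ℝ) → Prop) (N : ℤ) (X E : Fin m → ℤ → ℝ → ℝ) (t e : ℤ → ℝ) (τ₁ a : ℝ), 0 < ε₀ → n₀ ≤ N → Literature.Analysis.FluidPDE.TaoCascade.EpochCheckpoints ε₀ θ c i₀ n₀ X₀ P Q N X E t e → Literature.Analysis.FluidPDE.TaoCascade.StepTo ε₀ θ c i₀ P Q (Literature.Analysis.FluidPDE.TaoCascade.restartX ε₀ N (t N) (e N) X) (Literature.Analysis.FluidPDE.TaoCascade.restartE ε₀ N (t N) (e N) E) τ₁ a → Literature.Analysis.FluidPDE.TaoCascade.EpochCheckpoints ε₀ θ c i₀ n₀ X₀ P Q (N + 1) X E (Function.update t (N + 1) (t N + τ₁ / (e N * (1 + ε₀) ^ ((5 : ℝ)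 * N / 2)))) (Function.update e (N + 1) (a * e N))

/-- `RestartGlue` holds: proved by `Summit.NavierStokesRegularity.NavierStokesRegularity.Theorems.exactWindowRungThree_restartGlue_proof`. -/
theorem RestartGlue_holds : RestartGlue := _root_.Summit.NavierStokesRegularity.NavierStokesRegularity.Theorems.exactWindowRungThree_restartGlue_proof

/-- item stmt-NavierStokesRegularity-21752 · support · rank 9 · closed · proved by Summit.NavierStokesRegularity.NavierStokesRegularity.Theorems.trappingWindowRungThree_localDynamicsSufficesAt_proof (prover) · by planner
sources: Tao2016AveragedNS
[support] Support of route TaoLadderRungThree (item closed · proved by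
`Summit.NavierStokesRegularity.NavierStokesRegularity.Theorems.taoLadderRungTwo_localDynamicsSufficesAt_proof`),
re-wanted verbatim: DynamicsLocalAt ε₀ R yields a table in InTableClass R with NoGlobalCascade ε₀.
[difficulty: provable-now] -/
@[route_item "route-NavierStokesRegularity-HeteroclinicTriggerChain", crux]
def LocalDynamicsSufficesAt : Prop :=
  ∀ ε₀ R : ℝ, 0 < ε₀ → 1 ≤ R → Literature.Analysis.FluidPDE.TaoCascade.DynamicsLocalAt ε₀ R → ∃ (α : Fin 4 → Fin 4 → Fin 4 → ℤ × ℤ × ℤ → ℝ) (X₀ : Fin 4 → ℝ), Literature.Analysis.FluidPDE.TaoCascade.InTableClass R α ∧ Literature.Analysis.FluidPDE.TaoCascade.NoGlobalCascade ε₀ α X₀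

/-- `LocalDynamicsSufficesAt` holds: proved by `Summit.NavierStokesRegularity.NavierStokesRegularity.Theorems.trappingWindowRungThree_localDynamicsSufficesAt_proof`. -/
theorem LocalDynamicsSufficesAt_holds : LocalDynamicsSufficesAt := _root_.Summit.NavierStokesRegularity.NavierStokesRegularity.Theorems.trappingWindowRungThree_localDynamicsSufficesAt_proof

/-- item stmt-NavierStokesRegularity-22787 · assembly · rank 1 · closed · proved by Summit.NavierStokesRegularity.NavierStokesRegularity.Theorems.heteroclinicTriggerChain_assembly_proof (prover) · by planner
sources: Tao2016AveragedNS
[assembly] TriggerChainTable → TriggerChainFrontStep → RestartControl → RestartGlue →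
LocalDynamicsSufficesAt → rung TL-M3 target. -/
@[route_item "route-NavierStokesRegularity-HeteroclinicTriggerChain"]
def Assembly : Prop :=
  TriggerChainTable → TriggerChainFrontStep → RestartControl → RestartGlue → LocalDynamicsSufficesAt → Summit.NavierStokesRegularity.NavierStokesRegularity.Theses.TaoLadderRungThree.Target

-- `Assembly` holds: proved by `Summit.NavierStokesRegularity.NavierStokesRegularity.Theorems.heteroclinicTriggerChain_assembly_proof` (its module imports this route file, so no `_holds` link can be stated here).

/-! D-0027 §2.1 — DECIDING THEOREM (planner-authored via `route open/edit --closes-file`; by planner-ns-idea-4-g0-0 2026-08-27T21:15:55Z):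
its hypotheses are this route's items and its conclusion the registered leaf `Summit.NavierStokesRegularity.NavierStokesRegularity.Theses.TaoLadderRungThree.Target` (rung TL-M3, D-0061) (glue_lint), and it elaborates with this file. -/

@[closes "route-NavierStokesRegularity-HeteroclinicTriggerChain"] theorem closes (h₁ : TriggerChainTable) (h₂ : TriggerChainFrontStep) (h₃ : RestartControl)
    (h₄ : RestartGlue) (h₅ : LocalDynamicsSufficesAt) :
    Summit.NavierStokesRegularity.NavierStokesRegularity.Theses.TaoLadderRungThree.Target := by
  obtain ⟨R, hR, α₀, σ, hchain⟩ := h₁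
  obtain ⟨β, hβ, hβ1, θ, c, η, i₀, X₀, P, env, hθ0, hθ, hc, hη, hα, hX₀, hP, -, hstep⟩ :=
    h₂ R hR α₀ σ hchain
  have hR' : 1 ≤ R / β := by
    rw [le_div_iff₀ hβ]
    nlinarith
  -- work at a general scale ratio `ε₀ > 0`; specialise to the dyadic `ε₀ = 1` at the end
  obtain ⟨ε₀, hε₀, hε₁⟩ : ∃ ε₀ : ℝ, 0 < ε₀ ∧ ε₀ = 1 := ⟨1, one_pos, rfl⟩
  rw [← hε₁] at hstep
  have hdyn : Literature.Analysis.FluidPDE.TaoCascade.DynamicsLocalAt ε₀ (R / β) := by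
    refine ⟨θ, c, i₀, _, X₀, P,
      Literature.Analysis.FluidPDE.TaoCascade.epochEnvelope env, hθ0, by linarith, hc,
      hα, hX₀, hP, ?_⟩
    intro K₁ K₂ hK₁ hK₂
    obtain ⟨N₀, hN₀⟩ := h₃ ε₀ θ c η i₀ _ X₀ P env K₁ K₂ hε₀ hθ hc.le hη hX₀ hK₁ hK₂
    refine ⟨N₀, fun n₀ hn₀ T hT X E hsol N hN t e hcp hhor => ?_⟩
    have heN : 0 < e N := hcp.e_pos N hN le_rfl
    have hpow : 0 < (1 + ε₀) ^ ((5 : ℝ) * N / 2) := Real.rpow_pos_of_pos (by linarith) _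
    have hγ : 0 < e N * (1 + ε₀) ^ ((5 : ℝ) * N / 2) := mul_pos heN hpow
    have hneg : (1 + ε₀) ^ (-(5 : ℝ) * N / 2) = ((1 + ε₀) ^ ((5 : ℝ) * N / 2))⁻¹ := by
      rw [← Real.rpow_neg (by linarith : (0 : ℝ) ≤ 1 + ε₀)]
      congr 1
      ring
    have hcγ : c * (1 + ε₀) ^ (-(5 : ℝ) * N / 2) * (e N)⁻¹ =
        c / (e N * (1 + ε₀) ^ ((5 : ℝ) * N / 2)) := by
      rw [hneg]
      field_simp
    rw [hcγ] at hhor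
    have hdiv : 0 < c / (e N * (1 + ε₀) ^ ((5 : ℝ) * N / 2)) := div_pos hc hγ
    have htN : t N < T := by linarith
    have hτ : c ≤ (T - t N) * (e N * (1 + ε₀) ^ ((5 : ℝ) * N / 2)) := by
      have h2 : c / (e N * (1 + ε₀) ^ ((5 : ℝ) * N / 2)) ≤ T - t N := by linarith
      have h3 := mul_le_mul_of_nonneg_right h2 hγ.le
      rwa [div_mul_cancel₀ c hγ.ne'] at h3
    obtain ⟨hflow, hslack⟩ := hN₀ n₀ hn₀ T hT X E hsol N hN t e hcp htN
    obtain ⟨τ₁, a, hst⟩ :=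
      hstep (N - n₀).toNat _ _ _ (hcp.state N hN le_rfl) hslack _ hτ _ _ hflow
    exact ⟨_, _, h₄ ε₀ θ c 4 i₀ n₀ X₀ _ _ N X E t e τ₁ a hε₀ hN hcp hst⟩
  rw [hε₁] at hdyn
  obtain ⟨α', X₀', hα', hng⟩ := h₅ 1 (R / β) one_pos hR' hdyn
  exact ⟨R / β, hR', α', X₀', hα', hng⟩

end Summit.NavierStokesRegularity.NavierStokesRegularity.Theses.HeteroclinicTriggerChain
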